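import Mathlib
import HarnessLib
import Summits.ResolutionOfSingularities.ResolutionOfSingularities.Theorems.WildQuotientsWildQuotientResolutionJordanFiveRingBrickZeroOneShot
import Summits.ResolutionOfSingularities.ResolutionOfSingularities.Theorems.WildQuotientsWildQuotientResolutionJordanFiveChart0BrickGlue
import Summits.ResolutionOfSingularities.ResolutionOfSingularities.Theorems.WildQuotientsWildQuotientResolutionJordanFiveChart0WeightZero
import Summits.ResolutionOfSingularities.ResolutionOfSingularities.Theorems.WildQuotientsWildQuotientResolutionJordanFiveRootChart0Equiv
import Summits.ResolutionOfSingularities.ResolutionOfSingularities.Theorems.WildQuotientsWildQuotientResolutionJordanFiveChart0SeamFixed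
import Summits.ResolutionOfSingularities.ResolutionOfSingularities.Theorems.WildQuotientsWildQuotientResolutionJordanFiveX0ChartRing
import Summits.ResolutionOfSingularities.ResolutionOfSingularities.Theorems.WildQuotientsWildQuotientResolutionQuarter1123MulColon
import Summits.ResolutionOfSingularities.ResolutionOfSingularities.Theorems.WildQuotientsWildQuotientResolutionToricChartNoetherian
import Summits.ResolutionOfSingularities.ResolutionOfSingularities.Theorems.WildQuotientsWildQuotientResolutionToricExitWeightZero

/-!
# RUNG V5: the `μ₄` ONE-SHOT ring brick `H₀′` of the J₅ scaffold (assembly)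
(crux stmt-ResolutionOfSingularities-15640 `WildQuotients.WildQuotientResolution`, line `Sketch`;
chain w45c RUNG V5, β‴ «one-shot product centre» (res-L1-w45c-plan-1 RULING v8.4-B, design
`L/w45c/HP0-ONESHOT-DESIGN.md`): the hypothesis `H₀′` of res-L1-w45c-lead-1's
`JordanFive.coneBrick_zero_of_ringBrick'` (p536645) VERBATIM. [OURS · L1 W4.5c] — assembly of landed
decls; NOT a statement of any manuscript; replaces the role of no printed item. Assembler
res-L1-w45c-stub-4 (plan-1 ORDER 13:42:41Z / RULING 13:55:27Z).)

`JordanFive.brickHP0'`: for every lifted action `ρB` on `Bl_{I₁₂} 𝔸ⁿ → 𝔸ⁿ/⟨σ⟩`, every stable affine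
open `O₀ = chart 0` (the `μ₄` vertex chart `V[x_a³]`) and all chart ratios `T_j` (`j ∉ {0,2,5,13}`),
`T'_j` (`j ≠ 0`), there are `R₀ := ToricChart.Ring k P quarterDatum` (the presented `¼(1,1,2,3) × 𝔸^P`
cone ring, Noetherian), the reduced axis / vertex-line ideals `J₀ = faceIdeal {0,1,3}`, `J₀' = faceIdeal
univ` (radical), an injective `ψ : R₀ → Γ(O₀)` onto the invariants with the two radical identities, and
`Bl_{J₀·(J₀²:J₀')}` regular (`Quarter1123.blowup_regular_mulColon`, p535306).
Assembly: seam `exists_sectionsEquiv_chart0_appLE` + `BlowupExit.ringBrick_transport₂` (stub-5,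
p536366) ∘ [root-chart automorphism `exists_rootChart5Equiv` (stub-2, p537251) + chart-ring
identification `exists_ringEquiv_blowupChart0_weightZero` (lead-1, p538056) + fixedness bridge
`chart0_seamFixed_iff` (stub-2, p540516, over lead-1's `BlowupExit.map_away_fixed_iff_of_intertwines`
p539462) with `aeval_root5_comp_eq` (stub-2, p537251) + ring model `exists_ringBrick_X0_model` (stub-2,
p537855) + cone side (stub-4)]. The ring side is isolated in `brickHP0_ringSide` (small types) so that
the scheme-level statement `brickHP0'` is elaborated by ONE `Exists.elim` chain and ONE `exact`.
-/

-- single-problem summit: the doubled namespace component `ResolutionOfSingularities` is forced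
set_option linter.dupNamespace false

noncomputable section

open CategoryTheory AlgebraicGeometry TopologicalSpace MvPolynomial Polynomial HomogeneousLocalization
open Literature.AlgebraicGeometry.Resolution Literature.AlgebraicGeometry.RelativeSpec
open scoped Pointwise

namespace Summit.ResolutionOfSingularities.ResolutionOfSingularities.Theorems.WildQuotientResolution.JordanFive

/-- `x_a³ t ∈ k[x][I₁₂ t]` (local shorthand) -/
local notation3 "s₀[" k ", " n ", " a ", " b ", " c ", " d "]" =>
  (reesT (gens12 k n a b c d 0) (gens12_mem_I12 k n a b c d 0))
/-- the chart ring `B₀ = (k[x][I₁₂t])_{(x_a³ t)}` (local shorthand) -/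
local notation3 "B₀[" k ", " n ", " a ", " b ", " c ", " d "]" =>
  HomogeneousLocalization.Away (reesGrading (I12 k n a b c d)) s₀[k, n, a, b, c, d]
/-- the structure map `F ↦ F/1 : k[x] → B₀` (local shorthand) -/
local notation3 "base₀[" k ", " n ", " a ", " b ", " c ", " d "]" =>
  ((HomogeneousLocalization.fromZeroRingHom (reesGrading (I12 k n a b c d))
    (.powers s₀[k, n, a, b, c, d])).comp (reesGrading.zeroRingHom (I12 k n a b c d)))

set_option maxHeartbeats 1600000 in
/-- **The ring side of `H₀′`** = the hypothesis `H` of `BlowupExit.ringBrick_transport₂` (p536366) at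
the chart-0 letters: for all ratio families `t, t'` in `B₀` there are `R₀ := ToricChart.Ring k P
quarterDatum` (Noetherian), the radical face ideals `J₀ = faceIdeal {0,1,3}`, `J₀' = faceIdeal univ`,
an injective `ψC : R₀ → B₀` whose range is the `φ`-fixed part, the two radical identities, and
`Bl_{J₀·(J₀²:J₀')}` regular. Assembly of stub-2's `exists_rootChart5Equiv` / `exists_ringBrick_X0_model`
/ `chart0_seamFixed_iff`, lead-1's `exists_ringEquiv_blowupChart0_weightZero` and stub-4's
`Quarter1123.blowup_regular_mulColon`. [OURS · L1 W4.5c] [folklore; assembly of landed decls] -/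
theorem brickHP0_ringSide (p : ℕ) (hp : p.Prime) (hp5 : 5 ≤ p)
    (k : Type) [Field k] [CharP k p] (n : ℕ)
    (σ : MvPolynomial (Fin n) k ≃ₐ[k] MvPolynomial (Fin n) k) [Finite ↥(Subgroup.zpowers σ)]
    (a b c d e : Fin n) (hab : a ≠ b) (hac : a ≠ c) (had : a ≠ d) (hae : a ≠ e) (hbc : b ≠ c)
    (hbd : b ≠ d) (hbe : b ≠ e) (hcd : c ≠ d) (hce : c ≠ e) (hde : d ≠ e)
    (hb : σ (X b) = X b + X a) (hc : σ (X c) = X c + X b) (hd : σ (X d) = X d + X c)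
    (he : σ (X e) = X e + X d)
    (hσ : ∀ i, i ≠ b → i ≠ c → i ≠ d → i ≠ e → σ (X i) = X i)
    (φ : ↥(Subgroup.zpowers σ) → (reesGrading (I12 k n a b c d) →+*ᵍ reesGrading (I12 k n a b c d)))
    (hφ : ∀ (g : ↥(Subgroup.zpowers σ)) x, ((φ g x : reesAlgebra (I12 k n a b c d)) :
        (MvPolynomial (Fin n) k)[X]) =
      (x : (MvPolynomial (Fin n) k)[X]).map ((MulSemiringAction.toRingEquiv
        (↥(Subgroup.zpowers σ)) (MvPolynomial (Fin n) k) g⁻¹ : _ ≃+* _) : _ →+* _))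
    (hP : ∀ g, Submonoid.powers s₀[k, n, a, b, c, d] ≤
      (Submonoid.powers s₀[k, n, a, b, c, d]).comap (φ g))
    (t : {j : Fin 40 // j ≠ 0 ∧ j ≠ 2 ∧ j ≠ 5 ∧ j ≠ 13} → B₀[k, n, a, b, c, d])
    (t' : {j : Fin 40 // j ≠ 0} → B₀[k, n, a, b, c, d])
    (ht : ∀ j, base₀[k, n, a, b, c, d] (gens12 k n a b c d 0) * t j =
      base₀[k, n, a, b, c, d] (gens12 k n a b c d j.1))
    (ht' : ∀ j, base₀[k, n, a, b, c, d] (gens12 k n a b c d 0) * t' j =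
      base₀[k, n, a, b, c, d] (gens12 k n a b c d j.1)) :
    ∃ (R₀ : Type) (_ : CommRing R₀) (_ : IsNoetherianRing R₀) (J₀ J₀' : Ideal R₀)
      (ψC : R₀ →+* B₀[k, n, a, b, c, d]),
      Function.Injective ψC ∧
      (∀ y : B₀[k, n, a, b, c, d], y ∈ Set.range ψC ↔
        ∀ g, HomogeneousLocalization.map (φ g) (hP g) y = y) ∧
      J₀.IsRadical ∧ J₀'.IsRadical ∧
      ((Ideal.span (base₀[k, n, a, b, c, d] '' {X a, X b, X c, X d} ∪ Set.range t)).comap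
        ψC).radical = J₀ ∧
      ((Ideal.span (base₀[k, n, a, b, c, d] '' {X a, X b, X c, X d} ∪ Set.range t')).comap
        ψC).radical = J₀' ∧
      Scheme.IsRegular (affineBlowup (J₀ * (J₀ ^ 2).colon (J₀' : Set R₀))) := by
  classical
  -- the root-chart automorphism `σ_U`
  obtain ⟨σU, hUb, hUc, hUd, hUe, hσU⟩ :=
    exists_rootChart5Equiv k n a b c d e hab hac had hae hbc hbd hbe hcd hce hde
  -- the `μ₄` weight and its weight-`0` subalgebra
  let w₂ : Fin n → ZMod 4 := fun i => if i = a then 1 else if i = b then 1 else if i = c then 2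
    else if i = d then 3 else 0
  have hw₂a : w₂ a = 1 := by simp [w₂]
  have hw₂b : w₂ b = 1 := by simp [w₂, hab.symm]
  have hw₂c : w₂ c = 2 := by simp [w₂, hac.symm, hbc.symm]
  have hw₂d : w₂ d = 3 := by simp [w₂, had.symm, hbd.symm, hcd.symm]
  have hw₂0 : ∀ i, i ≠ a → i ≠ b → i ≠ c → i ≠ d → w₂ i = 0 := fun i h₁ h₂ h₃ h₄ => by
    simp [w₂, h₁, h₂, h₃, h₄]
  let E₀ : Subalgebra k (MvPolynomial (Fin n) k) :=
    Algebra.adjoin k {f : MvPolynomial (Fin n) k | IsWeightedHomogeneous w₂ f 0}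
  have hE₀ : ∀ f, f ∈ E₀ ↔ IsWeightedHomogeneous w₂ f 0 := fun f =>
    ⟨fun hf => ToricExit.isWeightedHomogeneous_zero_of_mem_adjoin w₂ _ (fun g hg => hg) f hf,
      fun hf => Algebra.subset_adjoin hf⟩
  -- the chart-ring identification (A1)
  obtain ⟨eE, heE₁, -⟩ := exists_ringEquiv_blowupChart0_weightZero k n a b c d hab hac had hbc
    hbd hcd w₂ hw₂a hw₂b hw₂c hw₂d hw₂0 E₀ hE₀
  -- the ring model (stub-2)
  obtain ⟨ψC, hinj, hrange, hJ, hJ'⟩ := exists_ringBrick_X0_model k n a b c d e p hab hac had hae hbc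
    hbd hbe hcd hce hde hp hp5 σU hUb hUc hUd hUe hσU w₂ hw₂a hw₂b hw₂c hw₂d hw₂0 E₀ hE₀
    base₀[k, n, a, b, c, d] eE heE₁ t ht t' ht'
  refine ⟨ToricChart.Ring k {i : Fin n // i ≠ a ∧ i ≠ b ∧ i ≠ c ∧ i ≠ d} Quarter1123.quarterDatum,
    inferInstance, ToricChart.isNoetherianRing_ring k _ _,
    ToricChart.faceIdeal k _ Quarter1123.quarterDatum {0, 1, 3},
    ToricChart.faceIdeal k _ Quarter1123.quarterDatum Finset.univ, ψC, hinj, fun y => ?_,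
    Quarter1123.isRadical_faceIdeal_axis k _, Quarter1123.isRadical_faceIdeal_univ k _, hJ, hJ',
    (Quarter1123.blowup_regular_mulColon k _).1⟩
  -- range = the `φ`-fixed part, by the fixedness bridge (B)
  exact Set.mem_range.trans (RingHom.mem_range.symm.trans ((hrange y).trans
    (chart0_seamFixed_iff k n a b c d σ (hσ a hab hac had hae) φ hφ hP E₀ eE heE₁ σU
      (aeval_root5_comp_eq k n a b c d e hab hac had hae hbc hbd hbe hcd hce hde σ σU hb hc hd he hσ
        hUb hUc hUd hUe hσU) y)))

-- the statement is the literal `H₀′` binder of p536645 (large chart / quotient terms): head-room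
set_option maxHeartbeats 8000000 in
/-- **The `μ₄` one-shot ring brick `H₀′` of the J₅ toric exit on chart `0`** = hypothesis `H₀′` of
`JordanFive.coneBrick_zero_of_ringBrick'` (p536645) verbatim; see the module docstring.
[OURS · L1 W4.5c] [folklore; assembly of landed decls] -/
theorem brickHP0' (p : ℕ) (hp : p.Prime) (hp5 : 5 ≤ p)
    (k : Type) [Field k] [CharP k p] (n : ℕ)
    (σ : MvPolynomial (Fin n) k ≃ₐ[k] MvPolynomial (Fin n) k) [Finite ↥(Subgroup.zpowers σ)]
    (a b c d e : Fin n) (hab : a ≠ b) (hac : a ≠ c) (had : a ≠ d) (hae : a ≠ e) (hbc : b ≠ c)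
    (hbd : b ≠ d) (hbe : b ≠ e) (hcd : c ≠ d) (hce : c ≠ e) (hde : d ≠ e)
    (hb : σ (X b) = X b + X a) (hc : σ (X c) = X c + X b) (hd : σ (X d) = X d + X c)
    (he : σ (X e) = X e + X d)
    (hσ : ∀ i, i ≠ b → i ≠ c → i ≠ d → i ≠ e → σ (X i) = X i)
    (ρ : ↥(Subgroup.zpowers σ) →* Aut (Spec (CommRingCat.of (MvPolynomial (Fin n) k))))
    (hρ : ∀ g : ↥(Subgroup.zpowers σ), (ρ g).hom = Spec.map (CommRingCat.ofHom
      ((MulSemiringAction.toRingEquiv (↥(Subgroup.zpowers σ)) (MvPolynomial (Fin n) k) g⁻¹ :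
        MvPolynomial (Fin n) k ≃+* MvPolynomial (Fin n) k) :
          MvPolynomial (Fin n) k →+* MvPolynomial (Fin n) k)))
    (ρB : ActionOver
      (affineBlowup.π (I12 k n a b c d) ≫
        Spec.map (CommRingCat.ofHom (algebraMap
          (FixedPoints.subalgebra k (MvPolynomial (Fin n) k) (Subgroup.zpowers σ))
          (MvPolynomial (Fin n) k))))
      ↥(Subgroup.zpowers σ))
    (hρB : ρB.aut = (affineBlowup.isBlowup (I12 k n a b c d)).liftAction ρ
      (idealSheaf_I12_comap k n a b c d hab hac had hbc hbd hcd σ (hσ a hab hac had hae) hb hc hd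
        ρ hρ))
    (O₀ : ρB.StableAffineOpens) (hO₀ : O₀.1 = chart k n a b c d 0)
    (hle : ((O₀.1.ι ≫ affineBlowup.π (I12 k n a b c d) ≫
        Spec.map (CommRingCat.ofHom (algebraMap
          (FixedPoints.subalgebra k (MvPolynomial (Fin n) k) (Subgroup.zpowers σ))
          (MvPolynomial (Fin n) k)))) ⁻¹ᵁ ⊤ : (O₀.1 : Scheme.{0}).Opens) ≤
      O₀.1.ι ⁻¹ᵁ chart k n a b c d 0)
    (T : {j : Fin 40 // j ≠ 0 ∧ j ≠ 2 ∧ j ≠ 5 ∧ j ≠ 13} →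
      Γ(affineBlowup (I12 k n a b c d), chart k n a b c d 0))
    (T' : {j : Fin 40 // j ≠ 0} → Γ(affineBlowup (I12 k n a b c d), chart k n a b c d 0))
    (hT : ∀ j, (affineBlowup.π (I12 k n a b c d)).appLE ⊤ (chart k n a b c d 0)
          (blowupChart_le_preimage _ _ _ _)
          ((Scheme.ΓSpecIso (CommRingCat.of (MvPolynomial (Fin n) k))).inv.hom
            (gens12 k n a b c d j.1)) =
        (affineBlowup.π (I12 k n a b c d)).appLE ⊤ (chart k n a b c d 0)
          (blowupChart_le_preimage _ _ _ _)
          ((Scheme.ΓSpecIso (CommRingCat.of (MvPolynomial (Fin n) k))).inv.hom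
            (gens12 k n a b c d 0)) * T j)
    (hT' : ∀ j, (affineBlowup.π (I12 k n a b c d)).appLE ⊤ (chart k n a b c d 0)
          (blowupChart_le_preimage _ _ _ _)
          ((Scheme.ΓSpecIso (CommRingCat.of (MvPolynomial (Fin n) k))).inv.hom
            (gens12 k n a b c d j.1)) =
        (affineBlowup.π (I12 k n a b c d)).appLE ⊤ (chart k n a b c d 0)
          (blowupChart_le_preimage _ _ _ _)
          ((Scheme.ΓSpecIso (CommRingCat.of (MvPolynomial (Fin n) k))).inv.hom
            (gens12 k n a b c d 0)) * T' j) :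
    ∃ (R₀ : Type) (_ : CommRing R₀) (_ : IsNoetherianRing R₀) (J₀ J₀' : Ideal R₀)
      (ψ : R₀ →+* Γ((O₀.1 : Scheme.{0}), (O₀.1.ι ≫ affineBlowup.π (I12 k n a b c d) ≫
        Spec.map (CommRingCat.ofHom (algebraMap
          (FixedPoints.subalgebra k (MvPolynomial (Fin n) k) (Subgroup.zpowers σ))
          (MvPolynomial (Fin n) k)))) ⁻¹ᵁ ⊤)),
      Function.Injective ψ ∧ ψ.range = (ρB.restrict O₀.1 O₀.2.1).invariantsRing ⊤ ∧
      J₀.IsRadical ∧ J₀'.IsRadical ∧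
      ((Ideal.span ((O₀.1.ι.appLE (chart k n a b c d 0)
          ((O₀.1.ι ≫ affineBlowup.π (I12 k n a b c d) ≫
            Spec.map (CommRingCat.ofHom (algebraMap
              (FixedPoints.subalgebra k (MvPolynomial (Fin n) k) (Subgroup.zpowers σ))
              (MvPolynomial (Fin n) k)))) ⁻¹ᵁ ⊤) hle) ''
        (((affineBlowup.π (I12 k n a b c d)).appLE ⊤ (chart k n a b c d 0)
            (blowupChart_le_preimage _ _ _ _)) ''
          ((Scheme.ΓSpecIso (CommRingCat.of (MvPolynomial (Fin n) k))).inv ''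
            {X a, X b, X c, X d}) ∪ Set.range T))).comap ψ).radical = J₀ ∧
      ((Ideal.span ((O₀.1.ι.appLE (chart k n a b c d 0)
          ((O₀.1.ι ≫ affineBlowup.π (I12 k n a b c d) ≫
            Spec.map (CommRingCat.ofHom (algebraMap
              (FixedPoints.subalgebra k (MvPolynomial (Fin n) k) (Subgroup.zpowers σ))
              (MvPolynomial (Fin n) k)))) ⁻¹ᵁ ⊤) hle) ''
        (((affineBlowup.π (I12 k n a b c d)).appLE ⊤ (chart k n a b c d 0)
            (blowupChart_le_preimage _ _ _ _)) ''
          ((Scheme.ΓSpecIso (CommRingCat.of (MvPolynomial (Fin n) k))).inv ''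
            {X a, X b, X c, X d}) ∪ Set.range T'))).comap ψ).radical = J₀' ∧
      Scheme.IsRegular (affineBlowup (J₀ * (J₀ ^ 2).colon (J₀' : Set R₀))) := by
  -- `I₁₂` is `⟨σ⟩`-stable
  have hI : ∀ g : ↥(Subgroup.zpowers σ), g • I12 k n a b c d = I12 k n a b c d :=
    smul_I12_eq k n a b c d hab hac had hbc hbd hcd σ (hσ a hab hac had hae) hb hc hd
  -- the seam (one `Exists.elim` chain, no `cases` on the large goal)
  refine (exists_sectionsEquiv_chart0_appLE k n σ a b c d e hab hac had hae hσ hI ρ hρ _ ρB hρB O₀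
    hO₀ hle).elim fun φ h₁ => h₁.elim fun hP h₂ => h₂.elim fun Ω h₃ => ?_
  -- transport of the ring side along the seam
  refine BlowupExit.ringBrick_transport₂ (B := B₀[k, n, a, b, c, d]) _ _ _
    (base₀[k, n, a, b, c, d] : MvPolynomial (Fin n) k → B₀[k, n, a, b, c, d]) Ω h₃.2.1 _
    (fun y => ∀ g, HomogeneousLocalization.map (φ g) (hP g) y = y) h₃.2.2.2 (gens12 k n a b c d 0)
    (fun j : {j : Fin 40 // j ≠ 0 ∧ j ≠ 2 ∧ j ≠ 5 ∧ j ≠ 13} => gens12 k n a b c d j.1)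
    (fun j : {j : Fin 40 // j ≠ 0} => gens12 k n a b c d j.1)
    ({X a, X b, X c, X d} : Set (MvPolynomial (Fin n) k)) T T' hT hT' ?_
  exact brickHP0_ringSide p hp hp5 k n σ a b c d e hab hac had hae hbc hbd hbe hcd hce hde hb hc hd he
    hσ φ h₃.1 hP

end Summit.ResolutionOfSingularities.ResolutionOfSingularities.Theorems.WildQuotientResolution.JordanFive

end
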